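import Mathlib
import Literature.Computability.AlgebraicComplexity.ArithCircuitProofs

/-!
# Route `CirculantFourier`, support item `RealForms` (stmt-ValiantsHypothesis-6310) — helper:
realification of complex arithmetic circuits

REALIFICATION (Bürgisser–Clausen–Shokrollahi 1997, §4.1-style simulation of `ℂ` by pairs of reals):
a fan-in-two arithmetic circuit over `ℂ` of size `s` computing `F ∈ ℂ[X_σ]` is simulated by a
fan-in-two circuit over `ℝ` of size `6 s` computing the coefficientwise real part `x` of `F`
(and, at the same cost, the imaginary part `y`), `F = x + i y` with `x y ∈ ℝ[X_σ]`:
every complex gate becomes a block of exactly six real gates (four auxiliary products / partial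
sums, then the real and the imaginary part), operands `X i ↦ (X i, 0)`, `c ↦ (re c, im c)`,
`gate j ↦ (gate (6j+4), gate (6j+5))`, junk (forward) references `↦ (0, 0)`.

Main results: `exists_real_parts_of_isFanInTwo` (circuit level) and
`exists_realPart_complexity_le` : `∃ x y, F = x + i y ∧ complexity x ≤ 6 * complexity F`;
`map_ofRealHom_eq_of_im_eq_zero` recovers `F = x` when all coefficients of `F` are real.

The file declares no `def`: blocks and operands are produced existentially.
-/

namespace Summit.ValiantsHypothesis.ValiantsHypothesis.Theorems.RealForms

-- `Summit.ValiantsHypothesis.ValiantsHypothesis.…` is the tree's mandated single-conjunct layout (Sub = Summit).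
set_option linter.dupNamespace false

open MvPolynomial Literature.Computability.AlgebraicComplexity ArithCircuit

noncomputable section

variable {σ : Type*}

/-- `C i * C i = -1` in `ℂ[X_σ]`. -/
theorem C_I_mul_C_I : (C Complex.I : MvPolynomial σ ℂ) * C Complex.I = -1 := by
  rw [← C_mul, Complex.I_mul_I, C_neg, C_1]

/-- A complex constant splits as `C c = C (re c) + C i * C (im c)` in `ℂ[X_σ]`. -/
theorem C_eq_re_add_im (c : ℂ) :
    (C c : MvPolynomial σ ℂ) = C (c.re : ℂ) + C Complex.I * C (c.im : ℂ) := by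
  rw [← C_mul, ← C_add]
  congr 1
  rw [mul_comm]
  exact (Complex.re_add_im c).symm

/-- OPERANDS. For a complex operand `u` read at stage `j` (against a complex value list of length
`j` and a real value list of length `6j` carrying real/imaginary parts at positions `6i+4`,
`6i+5`), there are two real operands reading — stably under extension of the real list — real
polynomials `x`, `y` with `u = x + i y`. Junk references (`gate j'`, `j' ≥ j`) become `const 0`. -/
theorem operand_realify (j : ℕ) (u : Operand ℂ σ) :
    ∃ uR uI : Operand ℝ σ, ∀ (vals : List (MvPolynomial σ ℂ)) (vals' : List (MvPolynomial σ ℝ)),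
      vals.length = j → vals'.length = 6 * j →
      (∀ i : ℕ, vals.getD i 0 = map Complex.ofRealHom (vals'.getD (6 * i + 4) 0) +
        C Complex.I * map Complex.ofRealHom (vals'.getD (6 * i + 5) 0)) →
      ∃ x y : MvPolynomial σ ℝ, (∀ ws, uR.eval (vals' ++ ws) = x) ∧
        (∀ ws, uI.eval (vals' ++ ws) = y) ∧
        u.eval vals = map Complex.ofRealHom x + C Complex.I * map Complex.ofRealHom y := by
  cases u with
  | var i =>
    refine ⟨.var i, .const 0, fun vals vals' _ _ _ => ⟨X i, 0, fun ws => rfl, fun ws => ?_, ?_⟩⟩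
    · simp [Operand.eval]
    · simp [Operand.eval]
  | const c =>
    refine ⟨.const c.re, .const c.im, fun vals vals' _ _ _ =>
      ⟨C c.re, C c.im, fun ws => rfl, fun ws => rfl, ?_⟩⟩
    simp only [Operand.eval, map_C, Complex.ofRealHom_eq_coe]
    exact C_eq_re_add_im c
  | gate j' =>
    by_cases h : j' < j
    · refine ⟨.gate (6 * j' + 4), .gate (6 * j' + 5), fun vals vals' hl hl' hinv =>
        ⟨vals'.getD (6 * j' + 4) 0, vals'.getD (6 * j' + 5) 0, fun ws => ?_, fun ws => ?_, ?_⟩⟩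
      · rw [Operand.eval_gate]
        exact List.getD_append _ _ _ _ (by omega)
      · rw [Operand.eval_gate]
        exact List.getD_append _ _ _ _ (by omega)
      · rw [Operand.eval_gate]
        exact hinv j'
    · refine ⟨.const 0, .const 0, fun vals vals' hl hl' hinv =>
        ⟨0, 0, fun ws => by simp [Operand.eval], fun ws => by simp [Operand.eval], ?_⟩⟩
      rw [Operand.eval_gate, List.getD_eq_default _ _ (by omega)]
      simp

/-- The left fold of six gates appends six values, each the value of its gate against the list
grown so far. -/
theorem foldl_six (vs : List (MvPolynomial σ ℝ)) (g0 g1 g2 g3 g4 g5 : Gate ℝ σ) :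
    ∃ v0 v1 v2 v3 v4 v5 : MvPolynomial σ ℝ,
      v0 = g0.eval vs ∧ v1 = g1.eval (vs ++ [v0]) ∧ v2 = g2.eval (vs ++ [v0, v1]) ∧
      v3 = g3.eval (vs ++ [v0, v1, v2]) ∧ v4 = g4.eval (vs ++ [v0, v1, v2, v3]) ∧
      v5 = g5.eval (vs ++ [v0, v1, v2, v3, v4]) ∧
      [g0, g1, g2, g3, g4, g5].foldl (fun vs g => vs ++ [g.eval vs]) vs =
        vs ++ [v0, v1, v2, v3, v4, v5] := by
  refine ⟨_, _, _, _, _, _, rfl, rfl, rfl, rfl, rfl, rfl, ?_⟩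
  simp only [List.foldl, List.append_assoc, List.cons_append, List.nil_append]

/-- LINEAR BLOCK. At stage `j`, the complex weighted sum `c • a + d • b` of two operands is
simulated by six real fan-in-two gates whose 5th and 6th values are its real and imaginary parts. -/
theorem block_lin (j : ℕ) (c d : ℂ) (a b : Operand ℂ σ) :
    ∃ blk : List (Gate ℝ σ), blk.length = 6 ∧ (∀ g' ∈ blk, g'.fanIn ≤ 2) ∧
      ∀ (vals : List (MvPolynomial σ ℂ)) (vals' : List (MvPolynomial σ ℝ)),
        vals.length = j → vals'.length = 6 * j →
        (∀ i : ℕ, vals.getD i 0 = map Complex.ofRealHom (vals'.getD (6 * i + 4) 0) +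
          C Complex.I * map Complex.ofRealHom (vals'.getD (6 * i + 5) 0)) →
        ∃ ws : List (MvPolynomial σ ℝ), ws.length = 6 ∧
          blk.foldl (fun vs g => vs ++ [g.eval vs]) vals' = vals' ++ ws ∧
          c • a.eval vals + d • b.eval vals =
            map Complex.ofRealHom (ws.getD 4 0) + C Complex.I * map Complex.ofRealHom (ws.getD 5 0) := by
  obtain ⟨aR, aI, ha⟩ := operand_realify j a
  obtain ⟨bR, bI, hb⟩ := operand_realify j b
  refine ⟨[.sum [(c.re, aR), (-c.im, aI)], .sum [(d.re, bR), (-d.im, bI)],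
    .sum [(c.im, aR), (c.re, aI)], .sum [(d.im, bR), (d.re, bI)],
    .sum [(1, .gate (6 * j)), (1, .gate (6 * j + 1))],
    .sum [(1, .gate (6 * j + 2)), (1, .gate (6 * j + 3))]], rfl, ?_, ?_⟩
  · intro g' hg'
    simp only [List.mem_cons, List.mem_nil_iff, or_false] at hg'
    rcases hg' with rfl | rfl | rfl | rfl | rfl | rfl <;> simp [Gate.fanIn, Gate.args]
  · intro vals vals' hl hl' hinv
    obtain ⟨xa, ya, hxa, hya, hA⟩ := ha vals vals' hl hl' hinv
    obtain ⟨xb, yb, hxb, hyb, hB⟩ := hb vals vals' hl hl' hinv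
    obtain ⟨v0, v1, v2, v3, v4, v5, h0, h1, h2, h3, h4, h5, hfold⟩ :=
      foldl_six vals' (.sum [(c.re, aR), (-c.im, aI)]) (.sum [(d.re, bR), (-d.im, bI)])
        (.sum [(c.im, aR), (c.re, aI)]) (.sum [(d.im, bR), (d.re, bI)])
        (.sum [(1, .gate (6 * j)), (1, .gate (6 * j + 1))])
        (.sum [(1, .gate (6 * j + 2)), (1, .gate (6 * j + 3))])
    have hxa0 : aR.eval vals' = xa := by simpa using hxa []
    have hya0 : aI.eval vals' = ya := by simpa using hya []
    have e0 : v0 = c.re • xa + (-c.im) • ya := by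
      rw [h0]; simp [Gate.eval, hxa0, hya0]
    have e1 : v1 = d.re • xb + (-d.im) • yb := by
      rw [h1]; simp [Gate.eval, hxb, hyb]
    have e2 : v2 = c.im • xa + c.re • ya := by
      rw [h2]; simp [Gate.eval, hxa, hya]
    have e3 : v3 = d.im • xb + d.re • yb := by
      rw [h3]; simp [Gate.eval, hxb, hyb]
    have e4 : v4 = v0 + v1 := by
      rw [h4]
      simp only [Gate.eval, List.map_cons, List.map_nil, List.sum_cons, List.sum_nil, add_zero,
        one_smul, Operand.eval_gate]
      rw [List.getD_append_right _ _ _ _ (by omega), List.getD_append_right _ _ _ _ (by omega)]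
      simp [hl']
    have e5 : v5 = v2 + v3 := by
      rw [h5]
      simp only [Gate.eval, List.map_cons, List.map_nil, List.sum_cons, List.sum_nil, add_zero,
        one_smul, Operand.eval_gate]
      rw [List.getD_append_right _ _ _ _ (by omega), List.getD_append_right _ _ _ _ (by omega)]
      simp [hl']
    refine ⟨[v0, v1, v2, v3, v4, v5], rfl, hfold, ?_⟩
    simp only [List.getD_cons_succ, List.getD_cons_zero]
    rw [e4, e5, e0, e1, e2, e3, hA, hB]
    simp only [smul_eq_C_mul, map_add, map_mul, map_C, map_neg, Complex.ofRealHom_eq_coe]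
    rw [C_eq_re_add_im c, C_eq_re_add_im d]
    linear_combination (C (c.im : ℂ) * map Complex.ofRealHom ya +
      C (d.im : ℂ) * map Complex.ofRealHom yb) * (C_I_mul_C_I (σ := σ))

/-- PRODUCT BLOCK. At stage `j`, the product `a * b` of two complex operands is simulated by six
real fan-in-two gates whose 5th and 6th values are its real and imaginary parts. -/
theorem block_mul (j : ℕ) (a b : Operand ℂ σ) :
    ∃ blk : List (Gate ℝ σ), blk.length = 6 ∧ (∀ g' ∈ blk, g'.fanIn ≤ 2) ∧
      ∀ (vals : List (MvPolynomial σ ℂ)) (vals' : List (MvPolynomial σ ℝ)),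
        vals.length = j → vals'.length = 6 * j →
        (∀ i : ℕ, vals.getD i 0 = map Complex.ofRealHom (vals'.getD (6 * i + 4) 0) +
          C Complex.I * map Complex.ofRealHom (vals'.getD (6 * i + 5) 0)) →
        ∃ ws : List (MvPolynomial σ ℝ), ws.length = 6 ∧
          blk.foldl (fun vs g => vs ++ [g.eval vs]) vals' = vals' ++ ws ∧
          a.eval vals * b.eval vals =
            map Complex.ofRealHom (ws.getD 4 0) + C Complex.I * map Complex.ofRealHom (ws.getD 5 0) := by
  obtain ⟨aR, aI, ha⟩ := operand_realify j a
  obtain ⟨bR, bI, hb⟩ := operand_realify j b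
  refine ⟨[.prod [aR, bR], .prod [aI, bI], .prod [aR, bI], .prod [aI, bR],
    .sum [(1, .gate (6 * j)), (-1, .gate (6 * j + 1))],
    .sum [(1, .gate (6 * j + 2)), (1, .gate (6 * j + 3))]], rfl, ?_, ?_⟩
  · intro g' hg'
    simp only [List.mem_cons, List.mem_nil_iff, or_false] at hg'
    rcases hg' with rfl | rfl | rfl | rfl | rfl | rfl <;> simp [Gate.fanIn, Gate.args]
  · intro vals vals' hl hl' hinv
    obtain ⟨xa, ya, hxa, hya, hA⟩ := ha vals vals' hl hl' hinv
    obtain ⟨xb, yb, hxb, hyb, hB⟩ := hb vals vals' hl hl' hinv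
    obtain ⟨v0, v1, v2, v3, v4, v5, h0, h1, h2, h3, h4, h5, hfold⟩ :=
      foldl_six vals' (.prod [aR, bR]) (.prod [aI, bI]) (.prod [aR, bI]) (.prod [aI, bR])
        (.sum [(1, .gate (6 * j)), (-1, .gate (6 * j + 1))])
        (.sum [(1, .gate (6 * j + 2)), (1, .gate (6 * j + 3))])
    have hxa0 : aR.eval vals' = xa := by simpa using hxa []
    have hxb0 : bR.eval vals' = xb := by simpa using hxb []
    have e0 : v0 = xa * xb := by
      rw [h0]; simp [Gate.eval, hxa0, hxb0]
    have e1 : v1 = ya * yb := by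
      rw [h1]; simp [Gate.eval, hya, hyb]
    have e2 : v2 = xa * yb := by
      rw [h2]; simp [Gate.eval, hxa, hyb]
    have e3 : v3 = ya * xb := by
      rw [h3]; simp [Gate.eval, hya, hxb]
    have e4 : v4 = v0 + -v1 := by
      rw [h4]
      simp only [Gate.eval, List.map_cons, List.map_nil, List.sum_cons, List.sum_nil, add_zero,
        one_smul, neg_smul, Operand.eval_gate]
      rw [List.getD_append_right _ _ _ _ (by omega), List.getD_append_right _ _ _ _ (by omega)]
      simp [hl']
    have e5 : v5 = v2 + v3 := by
      rw [h5]
      simp only [Gate.eval, List.map_cons, List.map_nil, List.sum_cons, List.sum_nil, add_zero,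
        one_smul, Operand.eval_gate]
      rw [List.getD_append_right _ _ _ _ (by omega), List.getD_append_right _ _ _ _ (by omega)]
      simp [hl']
    refine ⟨[v0, v1, v2, v3, v4, v5], rfl, hfold, ?_⟩
    simp only [List.getD_cons_succ, List.getD_cons_zero]
    rw [e4, e5, e0, e1, e2, e3, hA, hB]
    simp only [map_add, map_mul, map_neg]
    linear_combination (map Complex.ofRealHom ya * map Complex.ofRealHom yb) * (C_I_mul_C_I (σ := σ))

/-- GATES. Every fan-in-two complex gate at stage `j` is simulated by a block of exactly six real
fan-in-two gates: the 5th and 6th values of the block are the real and imaginary parts of the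
gate's value. -/
theorem gate_realify (j : ℕ) (g : Gate ℂ σ) (hg : g.fanIn ≤ 2) :
    ∃ blk : List (Gate ℝ σ), blk.length = 6 ∧ (∀ g' ∈ blk, g'.fanIn ≤ 2) ∧
      ∀ (vals : List (MvPolynomial σ ℂ)) (vals' : List (MvPolynomial σ ℝ)),
        vals.length = j → vals'.length = 6 * j →
        (∀ i : ℕ, vals.getD i 0 = map Complex.ofRealHom (vals'.getD (6 * i + 4) 0) +
          C Complex.I * map Complex.ofRealHom (vals'.getD (6 * i + 5) 0)) →
        ∃ ws : List (MvPolynomial σ ℝ), ws.length = 6 ∧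
          blk.foldl (fun vs g => vs ++ [g.eval vs]) vals' = vals' ++ ws ∧
          g.eval vals =
            map Complex.ofRealHom (ws.getD 4 0) + C Complex.I * map Complex.ofRealHom (ws.getD 5 0) := by
  cases g with
  | sum args =>
    rcases args with _ | ⟨⟨c, a⟩, _ | ⟨⟨d, b⟩, _ | ⟨e, rest⟩⟩⟩
    · obtain ⟨blk, h1, h2, h3⟩ := block_lin j 0 0 (.const 0 : Operand ℂ σ) (.const 0)
      refine ⟨blk, h1, h2, fun vals vals' hl hl' hinv => ?_⟩
      obtain ⟨ws, hw1, hw2, hw3⟩ := h3 vals vals' hl hl' hinv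
      refine ⟨ws, hw1, hw2, ?_⟩
      rw [← hw3]
      simp [Gate.eval]
    · obtain ⟨blk, h1, h2, h3⟩ := block_lin j c 0 a (.const 0)
      refine ⟨blk, h1, h2, fun vals vals' hl hl' hinv => ?_⟩
      obtain ⟨ws, hw1, hw2, hw3⟩ := h3 vals vals' hl hl' hinv
      refine ⟨ws, hw1, hw2, ?_⟩
      rw [← hw3]
      simp [Gate.eval]
    · obtain ⟨blk, h1, h2, h3⟩ := block_lin j c d a b
      refine ⟨blk, h1, h2, fun vals vals' hl hl' hinv => ?_⟩
      obtain ⟨ws, hw1, hw2, hw3⟩ := h3 vals vals' hl hl' hinv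
      refine ⟨ws, hw1, hw2, ?_⟩
      rw [← hw3]
      simp [Gate.eval]
    · exfalso
      simp [Gate.fanIn, Gate.args] at hg
  | prod args =>
    rcases args with _ | ⟨a, _ | ⟨b, _ | ⟨e, rest⟩⟩⟩
    · obtain ⟨blk, h1, h2, h3⟩ := block_mul j (.const 1 : Operand ℂ σ) (.const 1)
      refine ⟨blk, h1, h2, fun vals vals' hl hl' hinv => ?_⟩
      obtain ⟨ws, hw1, hw2, hw3⟩ := h3 vals vals' hl hl' hinv
      refine ⟨ws, hw1, hw2, ?_⟩
      rw [← hw3]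
      simp [Gate.eval, Operand.eval]
    · obtain ⟨blk, h1, h2, h3⟩ := block_mul j a (.const 1)
      refine ⟨blk, h1, h2, fun vals vals' hl hl' hinv => ?_⟩
      obtain ⟨ws, hw1, hw2, hw3⟩ := h3 vals vals' hl hl' hinv
      refine ⟨ws, hw1, hw2, ?_⟩
      rw [← hw3]
      simp [Gate.eval, Operand.eval]
    · obtain ⟨blk, h1, h2, h3⟩ := block_mul j a b
      refine ⟨blk, h1, h2, fun vals vals' hl hl' hinv => ?_⟩
      obtain ⟨ws, hw1, hw2, hw3⟩ := h3 vals vals' hl hl' hinv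
      refine ⟨ws, hw1, hw2, ?_⟩
      rw [← hw3]
      simp [Gate.eval]
    · exfalso
      simp [Gate.fanIn, Gate.args] at hg

/-- GATE LISTS. A list of fan-in-two complex gates is simulated by a list of six times as many
real fan-in-two gates whose value list carries, at positions `6i+4` and `6i+5`, the real and the
imaginary part of the `i`-th complex value (induction along the left fold `gateValues`). -/
theorem gates_realify (gs : List (Gate ℂ σ)) (hgs : ∀ g ∈ gs, g.fanIn ≤ 2) :
    ∃ gs' : List (Gate ℝ σ), gs'.length = 6 * gs.length ∧ (∀ g' ∈ gs', g'.fanIn ≤ 2) ∧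
      ∀ i : ℕ, (gateValues gs).getD i 0 =
        map Complex.ofRealHom ((gateValues gs').getD (6 * i + 4) 0) +
          C Complex.I * map Complex.ofRealHom ((gateValues gs').getD (6 * i + 5) 0) := by
  induction gs using List.reverseRecOn with
  | nil =>
    refine ⟨[], rfl, fun g' hg' => by simp at hg', fun i => ?_⟩
    simp [gateValues]
  | append_singleton gs g ih =>
    obtain ⟨gs', hlen, hfan, hinv⟩ := ih fun g0 hg0 => hgs g0 (by simp [hg0])
    have hg : g.fanIn ≤ 2 := hgs g (by simp)
    obtain ⟨blk, hblen, hbfan, hblk⟩ := gate_realify gs.length g hg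
    have hl : (gateValues gs).length = gs.length := gateValues_length gs
    have hl' : (gateValues gs').length = 6 * gs.length := by rw [gateValues_length, hlen]
    obtain ⟨ws, hws, hfold, hval⟩ := hblk (gateValues gs) (gateValues gs') hl hl' hinv
    refine ⟨gs' ++ blk, by simp [hlen, hblen]; ring, fun g' hg' => ?_, fun i => ?_⟩
    · rcases List.mem_append.mp hg' with h | h
      · exact hfan g' h
      · exact hbfan g' h
    · have hgv : gateValues (gs' ++ blk) = gateValues gs' ++ ws := by
        unfold gateValues at hfold ⊢
        rw [List.foldl_append]
        exact hfold
      rw [gateValues_append_singleton, hgv]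
      rcases Nat.lt_trichotomy i gs.length with hi | hi | hi
      · rw [List.getD_append _ _ _ _ (by omega), List.getD_append _ _ _ _ (by omega),
          List.getD_append _ _ _ _ (by omega)]
        exact hinv i
      · subst hi
        rw [List.getD_append_right _ _ _ _ (by omega), List.getD_append_right _ _ _ _ (by omega),
          List.getD_append_right _ _ _ _ (by omega), hl, hl', Nat.sub_self]
        simpa using hval
      · rw [List.getD_eq_default _ _ (by simp [hl]; omega),
          List.getD_eq_default _ _ (by simp [hl', hws]; omega),
          List.getD_eq_default _ _ (by simp [hl', hws]; omega)]
        simp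

/-- CIRCUITS. A fan-in-two complex circuit `P` is simulated by a fan-in-two real circuit of size
`6 · |P|` computing a real polynomial `x` with `P.eval = x + i y` for some real `y`. -/
theorem exists_real_parts_of_isFanInTwo {P : ArithCircuit ℂ σ} (hP : P.IsFanInTwo) :
    ∃ (Q : ArithCircuit ℝ σ) (x y : MvPolynomial σ ℝ), Q.IsFanInTwo ∧ Q.size = 6 * P.size ∧
      Q.eval = x ∧ P.eval = map Complex.ofRealHom x + C Complex.I * map Complex.ofRealHom y := by
  obtain ⟨gs', hlen, hfan, hinv⟩ := gates_realify P.gates hP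
  obtain ⟨uR, uI, hu⟩ := operand_realify P.size P.output
  have hl : (gateValues P.gates).length = P.size := gateValues_length P.gates
  have hl' : (gateValues gs').length = 6 * P.size := by
    rw [gateValues_length, hlen]; rfl
  obtain ⟨x, y, hx, -, hval⟩ := hu (gateValues P.gates) (gateValues gs') hl hl' hinv
  refine ⟨⟨gs', uR⟩, x, y, hfan, hlen, ?_, hval⟩
  simpa [ArithCircuit.eval] using hx []

/-- COMPLEXITY OF THE REAL PART: every `F ∈ ℂ[X_σ]` splits as `F = x + i y` with real `x`, `y`
and `L_ℝ(x) ≤ 6 · L_ℂ(F)`. -/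
theorem exists_realPart_complexity_le (F : MvPolynomial σ ℂ) :
    ∃ x y : MvPolynomial σ ℝ,
      F = map Complex.ofRealHom x + C Complex.I * map Complex.ofRealHom y ∧
      complexity x ≤ 6 * complexity F := by
  obtain ⟨P, hP1, hP2, hP3⟩ := exists_computes_size_eq_complexity F
  obtain ⟨Q, x, y, hQ1, hQ2, hQ3, hQ4⟩ := exists_real_parts_of_isFanInTwo hP1
  refine ⟨x, y, ?_, ?_⟩
  · rw [← hQ4]; exact hP2.symm
  · rw [← hP3, ← hQ2]
    exact complexity_le_size hQ1 hQ3

/-- REAL POLYNOMIALS. If `F = x + i y` with real `x`, `y` and every coefficient of `F` is real,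
then `F` is the image of `x`. -/
theorem map_ofRealHom_eq_of_im_eq_zero {F : MvPolynomial σ ℂ} {x y : MvPolynomial σ ℝ}
    (hF : F = map Complex.ofRealHom x + C Complex.I * map Complex.ofRealHom y)
    (him : ∀ m, (coeff m F).im = 0) : map Complex.ofRealHom x = F := by
  have hy : y = 0 := by
    ext m
    have h := him m
    rw [hF] at h
    simpa [coeff_map, coeff_C_mul] using h
  rw [hF, hy]
  simp

end

end Summit.ValiantsHypothesis.ValiantsHypothesis.Theorems.RealForms
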